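import Literature.AlgebraicGeometry.Modules.GrothendieckComplexOfProper
import Literature.AlgebraicGeometry.Modules.GrothendieckComplexKernelRepr
import Literature.AlgebraicGeometry.Morphisms.SectionsLiftOfFibreVanishing
import Literature.Algebra.Homology.KerZeroOfQuasiIsoNatural
import HarnessLib

/-!
# `H⁰` of a vector bundle on a proper flat scheme is the kernel of a map of finite projective modules, universally
# (Mumford, *Abelian Varieties*, §5 Lemmas 1–2 and Cor. 2; Görtz–Wedhorn II, Cor. 23.135 with (23.28.5); EGA III 7.7.6)

Topic `Literature/AlgebraicGeometry/Modules`; theorems only (no definition, no named fact, no instance, no notation, no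
`sorry`).  Cell hodgecm-mathlib, F-DAG F-6 (I) brick U1 (census `B-provers/B-p15/g12/CENSUS-F6I-GeomConnectedOpen.B-p15g12.md`,
B-plan1 (g15) GO 06:20:19Z 2026-08-30): the `K•`-LEVEL KERNEL REPRESENTATION for an ARBITRARY proper flat morphism.
★ `Modules/GrothendieckComplexKernelRepr` / `Modules/RelativeGrothendieckComplexKernelRepr` (`kernelReprEquiv`) do this for
PRODUCT families `P ×_K T → T` / `P ×_R T → T`; for a general proper flat `g : X → B` the tree stopped at the ČECH level
(★ `Modules/GrothendieckComplexOfProper.exists_secMod_top_linearEquiv_ker_baseChange`, whose terms are not finitely generated).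
Here the Čech-level representation is transported along the strictly perfect quasi-isomorphism `ψ : K• → Č•(𝓤, G)` of ★
`exists_strictlyPerfect_quasiIso_cechComplex_of_isProper` by Mumford's Lemma 2 in degree `0`
(★ `Algebra/Homology/KerZeroOfQuasiIsoNatural.kerZeroBaseChangeMap_bijective`), so that `s ↦ h⁰(X_s, G_s)` becomes the fibre
rank of the kernel of ONE map `d : K⁰ → K¹` of finite projective `Γ(B, 𝒪_B)`-modules — the input of ★
`Algebra/Module/TwoTermComplexBaseChange.isClosed_setOf_le_finrank_ker_baseChange` (upper semicontinuity, U2).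
HC_CM is proved only modulo the 7 printed citations until rung 0 closes; nothing here bears on a summit statement.

Setting: `g : X ⟶ B` proper and flat, `B` affine and locally noetherian, `G` finite locally free on `X` (`Scheme.{0}`, the
universe of the (h2) chain).  Sections are `SecMod G g♯ ⊤ = Γ(X, G)` as a `Γ(B, 𝒪_B)`-module through `g♯ = g.appTop.hom`, test
objects are cartesian squares `X′ = X ×_B B′ → B′` over an AFFINE `j : B′ → B` with `Γ(B, 𝒪) → Γ(B′, 𝒪)` in `appLE ⊤ ⊤` form
(★ `Modules/AffineTestObjects` / `GrothendieckComplexOfProper` conventions).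

* `cechComplex_d_zero_one_hom_eq_sysD` — `d⁰` of the module Čech complex is `OrderedCech.sysD _ 0` (bookkeeping);
* **`exists_grothendieck_ker_repr_of_cover`** — for a finite cover `𝓤` with affine finite intersections: a strictly perfect
  `K•` in degrees `[0, #ι]` with finite projective terms, a quasi-isomorphism `ψ : K• → Č•(𝓤, G)`, and for EVERY affine test
  square a `Γ(B′, 𝒪)`-linear `Γ(X′, k^*G) ≃ ker(d⁰_K ⊗ Γ(B′, 𝒪))`;
* **`exists_twoTerm_ker_repr`** — cover-free headline: finite projective `K⁰ K¹` and `d : K⁰ ⟶ K¹` over `Γ(B, 𝒪_B)` with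
  `Γ(X ×_B B′, k^*G) ≃ₗ[Γ(B′, 𝒪)] ker(d ⊗ Γ(B′, 𝒪))` for every affine test square.

## References
* D. Mumford, *Abelian Varieties*, TIFR Studies in Mathematics 5 (1970), §5, Lemmas 1–2 and Cor. 2 (pp. 46–51). [MumfordAV1970]
* U. Görtz, T. Wedhorn, *Algebraic Geometry II: Cohomology of Schemes* (2023), Cor. 23.135 (p. 355), (23.28.5), Rem. 21.92 (2),
  Lemma 21.93. [GortzWedhorn2023]
* A. Grothendieck, EGA III₂ (Publ. Math. IHÉS 17, 1963), (6.10.5), 7.7.6. [EGAIII2]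
-/

noncomputable section

set_option backward.isDefEq.respectTransparency false

open CategoryTheory CategoryTheory.Limits Opposite TopologicalSpace AlgebraicGeometry TensorProduct
open Literature.Algebra.Homology

namespace Literature.AlgebraicGeometry.Modules

open Literature.AlgebraicGeometry.Morphisms Literature.AlgebraicGeometry.HodgeTheory Literature.AlgebraicGeometry.Motives

section Cover

variable {X B : Scheme.{0}} (g : X ⟶ B) [IsAffine B] [IsProper g] [Flat g] [IsLocallyNoetherian B]
  {ι : Type} [LinearOrder ι] [Fintype ι] (U : ι → X.Opens) (hcov : ⨆ i, U i = ⊤)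
  (hUa : ∀ s : Finset ι, s.Nonempty → IsAffineOpen (cechOpen U s)) (G : X.Modules) (hL : IsFiniteLocallyFree G)

omit [IsAffine B] [IsProper g] [Flat g] [IsLocallyNoetherian B] [Fintype ι] in
/-- `d⁰` of the module Čech complex `Č•(𝓤, G)` is the ordered Čech differential `sysD _ 0` (★ `OrderedCech.sysComplex_d` at
`n = 0`, with `0 + 1` read as `1`). [cite: GortzWedhorn2023, Def. 21.68 (p. 180)] -/
theorem cechComplex_d_zero_one_hom_eq_sysD :
    ((cechComplex U G g.appTop.hom).d 0 1).hom = OrderedCech.sysD (sectionsSystem U G g.appTop.hom) 0 := by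
  have := OrderedCech.sysComplex_d (sectionsSystem U G g.appTop.hom) 0
  exact congrArg ModuleCat.Hom.hom this

include hcov hUa hL in
/-- **The Grothendieck complex computes `H⁰` after every affine base change, for an arbitrary proper flat morphism**
(Mumford §5 Lemmas 1–2 / Görtz–Wedhorn II Cor. 23.135 with (23.28.5)): for `g : X → B` proper flat over an affine locally
noetherian `B`, `G` finite locally free and a finite cover `𝓤` of `X` with affine finite intersections, there are a complex `K•`
of finite projective `Γ(B, 𝒪_B)`-modules in degrees `[0, #ι]`, a quasi-isomorphism `ψ : K• → Č•(𝓤, G)`, and for EVERY cartesian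
square `X′ → B′` over an affine `j : B′ → B` a `Γ(B′, 𝒪)`-linear isomorphism `Γ(X′, k^*G) ≃ ker(d⁰_K ⊗ Γ(B′, 𝒪))` (★ Čech-level
representation `exists_secMod_top_linearEquiv_ker_baseChange`, then `ker(d⁰_Č ⊗ B′) ≃ ker(d⁰_K ⊗ B′)` by ★
`kerZeroBaseChangeMap_bijective` — Mumford's Lemma 2 in degree `0`, both complexes being termwise flat in degrees `[0, #ι]`).
[cite: MumfordAV1970, §5, Lemmas 1–2 and Cor. 2] [cite: GortzWedhorn2023, Cor. 23.135 (p. 355) and (23.28.5)] -/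
theorem exists_grothendieck_ker_repr_of_cover :
    ∃ (K : CochainComplex (ModuleCat.{0} Γ(B, ⊤)) ℤ) (ψ : K ⟶ cechComplex U G g.appTop.hom),
      QuasiIso ψ ∧ K.IsStrictlyGE 0 ∧ K.IsStrictlyLE (Fintype.card ι : ℤ) ∧
      (∀ n, Module.Finite Γ(B, ⊤) (K.X n) ∧ Module.Projective Γ(B, ⊤) (K.X n)) ∧
      ∀ ⦃X' B' : Scheme.{0}⦄ (k : X' ⟶ X) (g' : X' ⟶ B') (j : B' ⟶ B) [IsAffine B'], IsPullback k g' g j →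
        letI := (j.appLE ⊤ ⊤ le_top).hom.toAlgebra
        Nonempty (SecMod ((Scheme.Modules.pullback k).obj G) g'.appTop.hom ⊤ ≃ₗ[Γ(B', ⊤)]
            LinearMap.ker ((K.d 0 1).hom.baseChange Γ(B', ⊤))) := by
  obtain ⟨K, ψ, hψ, hGE, hLE, hfp⟩ :=
    exists_strictlyPerfect_quasiIso_cechComplex_of_isProper g U hcov hUa G hL (Fintype.card ι) (by omega)
  refine ⟨K, ψ, hψ, hGE, hLE, hfp, ?_⟩
  intro X' B' k g' j _ H
  letI := (j.appLE ⊤ ⊤ le_top).hom.toAlgebra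
  have hG : IsAffineLocalizing G := (coh_of_isVectorBundle hL.isVectorBundle).loc
  obtain ⟨e', -⟩ := exists_secMod_top_linearEquiv_ker_baseChange H U hUa G hcov hG
  haveI := hψ
  haveI := hGE
  haveI := hLE
  haveI : (cechComplex U G g.appTop.hom).IsStrictlyGE 0 := isStrictlyGE_cechComplex _ _ _
  haveI : (cechComplex U G g.appTop.hom).IsStrictlyLE (Fintype.card ι : ℤ) :=
    isStrictlyLE_cechComplex _ _ _ _ (by omega)
  have hbij := kerZeroBaseChangeMap_bijective ψ Γ(B', ⊤)
    (fun n => by haveI := (hfp n).2; exact Module.Flat.of_projective)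
    (flat_cechComplex_X U G _ (flat_secMod_of_flat g U hUa G hL)) (Fintype.card ι : ℤ)
  let eK := LinearEquiv.ofBijective (kerZeroBaseChangeMap ψ Γ(B', ⊤)) hbij
  let eC := kerBaseChangeCongr (B := Γ(B', ⊤)) (cechComplex_d_zero_one_hom_eq_sysD g U G)
  exact ⟨e'.trans (eC.symm.trans eK.symm)⟩

end Cover

section CoverFree

variable {X B : Scheme.{0}} (g : X ⟶ B) [IsAffine B] [IsProper g] [Flat g] [IsLocallyNoetherian B]
  (G : X.Modules) (hL : IsFiniteLocallyFree G)

include hL in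
/-- **`H⁰` IS UNIVERSALLY THE KERNEL OF A MAP OF FINITE PROJECTIVE MODULES** (cover-free headline; Mumford §5 Cor. 2's
two-term complex `K⁰ → K¹`, EGA III 7.7.6): for `g : X → B` proper and flat over an affine locally noetherian `B` and `G`
finite locally free, there are finite projective `Γ(B, 𝒪_B)`-modules `K⁰, K¹` and `d : K⁰ → K¹` such that for EVERY cartesian
square `X′ → B′` over an affine `j : B′ → B`: `Γ(X′, k^*G) ≃ₗ[Γ(B′, 𝒪)] ker(d ⊗ Γ(B′, 𝒪))`.  In particular (test object
`Spec κ(b) → B`) `h⁰(X_b, G_b) = dim_{κ(b)} ker(d ⊗ κ(b))` is the fibre rank of a two-term complex of vector bundles.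
[cite: MumfordAV1970, §5, Cor. 2 (p. 50)] [cite: GortzWedhorn2023, Cor. 23.135 (p. 355)] [cite: EGAIII2, 7.7.6] -/
theorem exists_twoTerm_ker_repr :
    ∃ (K0 K1 : ModuleCat.{0} Γ(B, ⊤)) (d : K0 ⟶ K1),
      (Module.Finite Γ(B, ⊤) K0 ∧ Module.Projective Γ(B, ⊤) K0 ∧ Module.Finite Γ(B, ⊤) K1 ∧
        Module.Projective Γ(B, ⊤) K1) ∧
      ∀ ⦃X' B' : Scheme.{0}⦄ (k : X' ⟶ X) (g' : X' ⟶ B') (j : B' ⟶ B) [IsAffine B'], IsPullback k g' g j →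
        letI := (j.appLE ⊤ ⊤ le_top).hom.toAlgebra
        Nonempty (SecMod ((Scheme.Modules.pullback k).obj G) g'.appTop.hom ⊤ ≃ₗ[Γ(B', ⊤)]
            LinearMap.ker (d.hom.baseChange Γ(B', ⊤))) := by
  obtain ⟨ι, _, _, U, hcov, hUa⟩ := exists_finite_affine_cover_cechOpen g
  obtain ⟨K, ψ, -, -, -, hfp, hθ⟩ := exists_grothendieck_ker_repr_of_cover g U hcov hUa G hL
  exact ⟨K.X 0, K.X 1, K.d 0 1, ⟨(hfp 0).1, (hfp 0).2, (hfp 1).1, (hfp 1).2⟩, hθ⟩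

end CoverFree

end Literature.AlgebraicGeometry.Modules

end
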